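import Mathlib.Analysis.Convex.Measure
import Literature.InformationTheory.Entanglement.TwoRebitSeparabilityProbabilityFibre
import Literature.Probability.RandomMatrix.TwoQubitSeparabilityVolumesRebitHolds
import HarnessLib

/-!
# Two-rebit separability probability `29/64` on every fibre (Lovas–Andai 2017, Corollary 2 with
# Theorem 2): the discharge of `LovasAndai2017_rebit_fibre_2964`

Sibling proof file of `Literature/InformationTheory/Entanglement/TwoRebitSeparabilityProbability.lean`.
Theorem-only; nothing is defined here. It discharges the named fact

* `LovasAndai2017_rebit_fibre_2964 : ∀ D ≻ 0, Tr D = 1 → 64 · λ₇(P_ℝ(D)) = 29 · λ₇(D_ℝ(D))`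
  (closed fibre bodies `rebitFibrePPTBody D ⊆ rebitFibreBody D`, `Matrix.PosSemidef` typing)

along the architecture of the printed proof [LovasAndai2017, p. 8]:

* Corollary 2 (Milz–Strunz invariance over the reduced state), proved in
  `…/TwoRebitSeparabilityProbabilityFibre.lean` (`LovasAndai2017_rebit_fibre_2964_of_one`,
  `rebitFibre_identity_congr_iff`: the congruence `ρ ↦ (1 ⊗ M) ρ (1 ⊗ M)ᵀ` transports the fibre
  bodies with a common Jacobian), reduces the fact to the single fibre over `D = ½·1₂`;
* on that fibre the chart `rebitFibreDensity (½·1)` is literally the chart `rebitFibreMatrix` of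
  `Literature/Probability/RandomMatrix/TwoQubitSeparabilityVolumes.lean`
  (`rebitFibreDensity_half_eq`), where Theorem 2 with Corollary 2 is the THEOREM
  `Literature.Probability.RandomMatrix.LovasAndai2017_rebit_fibre_separability_probability_holds`
  (`…RebitHolds.lean`: Schur `Z`-sections, Lemma 6, and the dilogarithmic integral of the proof of
  Theorem 2), typed with Lovas–Andai's OPEN (faithful, `Matrix.PosDef`) bodies;
* the closed and the open fibre bodies have the same volume: the chart is affine, the open bodies
  are convex, the closed ones lie in their closures (segment to the maximally mixed state `¼·1₄`),
  and the frontier of a convex set is Lebesgue-null (`Convex.addHaar_frontier`) — the same remark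
  as for the `9`-dimensional bodies in `…/TwoRebitSeparabilityProbabilityProofs.lean`.

## References

* [LovasAndai2017] A. Lovas, A. Andai, *Invariance of separability probability over reduced states
  in 4 × 4 bipartite systems*, J. Phys. A 50 (2017) 295303, arXiv:1610.01410: Corollary 2,
  Theorem 2 (p. 8), §2 (faithful states), §3 (`𝒟_{4,𝕂}(D)`, the involution `T`).
-/

noncomputable section

open MeasureTheory Set
open scoped ENNReal Matrix

namespace Literature.InformationTheory.Entanglement

open Literature.Probability.RandomMatrix (rebitFibreMatrix rebitFibreMatrixPT
  LovasAndai2017_rebit_fibre_separability_probability)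

/-! ### The central fibre chart is the chart of `Literature/Probability/RandomMatrix` -/

/-- On the fibre over `½·1₂` the chart `rebitFibreDensity` is literally `rebitFibreMatrix`.
[cite: LovasAndai2017, §3 (the fibre 𝒟_{4,𝕂}(D))] -/
theorem rebitFibreDensity_half_eq :
    rebitFibreDensity ((2 : ℝ)⁻¹ • (1 : Matrix (Fin 2) (Fin 2) ℝ)) = rebitFibreMatrix := by
  funext x
  exact rebitFibreDensity_half x

/-- … and the partial-transpose charts coincide as well. [cite: LovasAndai2017, §3 (the involution T)] -/
theorem rebitFibreDensityPT_half_eq :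
    rebitFibreDensityPT ((2 : ℝ)⁻¹ • (1 : Matrix (Fin 2) (Fin 2) ℝ)) = rebitFibreMatrixPT := by
  funext x
  exact rebitFibreDensityPT_half x

/-! ### The fibre chart is affine; the open fibre bodies are convex -/

/-- The fibre chart `x ↦ ρ_D(x)` is affine. [folklore] -/
theorem rebitFibreDensity_lineComb (D : Matrix (Fin 2) (Fin 2) ℝ) (a b : ℝ) (hab : a + b = 1)
    (x x' : Fin 7 → ℝ) :
    rebitFibreDensity D (a • x + b • x') = a • rebitFibreDensity D x + b • rebitFibreDensity D x' := by
  ext i j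
  fin_cases i <;> fin_cases j <;> simp [rebitFibreDensity, Matrix.add_apply] <;>
    first
    | ring1
    | linear_combination (-(D 0 0)) * hab
    | linear_combination (-(D 0 1)) * hab
    | linear_combination (-(D 1 0)) * hab
    | linear_combination (-(D 1 1)) * hab

/-- The partial-transpose fibre chart is affine. [folklore] -/
theorem rebitFibreDensityPT_lineComb (D : Matrix (Fin 2) (Fin 2) ℝ) (a b : ℝ) (hab : a + b = 1)
    (x x' : Fin 7 → ℝ) :
    rebitFibreDensityPT D (a • x + b • x') =
      a • rebitFibreDensityPT D x + b • rebitFibreDensityPT D x' := by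
  ext i j
  fin_cases i <;> fin_cases j <;> simp [rebitFibreDensityPT, Matrix.add_apply] <;>
    first
    | ring1
    | linear_combination (-(D 0 0)) * hab
    | linear_combination (-(D 0 1)) * hab
    | linear_combination (-(D 1 0)) * hab
    | linear_combination (-(D 1 1)) * hab

/-- The OPEN fibre body `{x | ρ_D(x) ≻ 0}` (faithful states of the fibre) is convex.
[cite: LovasAndai2017, §2 (𝒟_{n,𝕂}, D > 0) and §3 (𝒟_{4,𝕂}(D))] -/
theorem convex_setOf_posDef_rebitFibreDensity (D : Matrix (Fin 2) (Fin 2) ℝ) :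
    Convex ℝ {x : Fin 7 → ℝ | (rebitFibreDensity D x).PosDef} := by
  intro x hx x' hx' a b ha hb hab
  simp only [Set.mem_setOf_eq] at hx hx' ⊢
  rw [rebitFibreDensity_lineComb D a b hab]
  rcases ha.eq_or_lt with rfl | ha'
  · rw [zero_add] at hab
    subst hab
    simpa using hx'
  · exact (hx.smul ha').add_posSemidef (hx'.posSemidef.smul hb)

/-- The open locus `{x | ρ_D(x)^Γ ≻ 0}` is convex. [cite: LovasAndai2017, §3 (T(𝒟_{4,𝕂}))] -/
theorem convex_setOf_posDef_rebitFibreDensityPT (D : Matrix (Fin 2) (Fin 2) ℝ) :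
    Convex ℝ {x : Fin 7 → ℝ | (rebitFibreDensityPT D x).PosDef} := by
  intro x hx x' hx' a b ha hb hab
  simp only [Set.mem_setOf_eq] at hx hx' ⊢
  rw [rebitFibreDensityPT_lineComb D a b hab]
  rcases ha.eq_or_lt with rfl | ha'
  · rw [zero_add] at hab
    subst hab
    simpa using hx'
  · exact (hx.smul ha').add_posSemidef (hx'.posSemidef.smul hb)

/-- The open PPT fibre body `{x | ρ_D(x) ≻ 0 ∧ ρ_D(x)^Γ ≻ 0}` is convex.
[cite: LovasAndai2017, §3 (𝒟ˢ = T(𝒟) ∩ 𝒟)] -/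
theorem convex_setOf_posDef_fibre_ppt (D : Matrix (Fin 2) (Fin 2) ℝ) :
    Convex ℝ {x : Fin 7 → ℝ | (rebitFibreDensity D x).PosDef ∧ (rebitFibreDensityPT D x).PosDef} :=
  (convex_setOf_posDef_rebitFibreDensity D).inter (convex_setOf_posDef_rebitFibreDensityPT D)

/-! ### The closed central fibre bodies sit between the open ones and their closures -/

/-- The chart point `(¼, ¼, 0, 0, 0, 0, 0)` of the maximally mixed state: `ρ_{½·1} = ¼·1₄` there.
[folklore] -/
theorem rebitFibreDensity_centre :
    rebitFibreDensity ((2 : ℝ)⁻¹ • (1 : Matrix (Fin 2) (Fin 2) ℝ)) ![1 / 4, 1 / 4, 0, 0, 0, 0, 0] =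
      (1 / 4 : ℝ) • (1 : Matrix (Fin 4) (Fin 4) ℝ) := by
  ext i j
  fin_cases i <;> fin_cases j <;> simp [rebitFibreDensity] <;> norm_num

/-- … and `ρ_{½·1}^Γ = ¼·1₄` there as well. [folklore] -/
theorem rebitFibreDensityPT_centre :
    rebitFibreDensityPT ((2 : ℝ)⁻¹ • (1 : Matrix (Fin 2) (Fin 2) ℝ)) ![1 / 4, 1 / 4, 0, 0, 0, 0, 0] =
      (1 / 4 : ℝ) • (1 : Matrix (Fin 4) (Fin 4) ℝ) := by
  ext i j
  fin_cases i <;> fin_cases j <;> simp [rebitFibreDensityPT] <;> norm_num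

/-- `D_ℝ(½·1) ⊆ closure {ρ ≻ 0}`: the open segment from a state of the fibre to `¼·1₄` consists of
faithful states of the fibre. [folklore] -/
theorem rebitFibreBody_half_subset_closure :
    rebitFibreBody ((2 : ℝ)⁻¹ • (1 : Matrix (Fin 2) (Fin 2) ℝ)) ⊆
      closure {x : Fin 7 → ℝ |
        (rebitFibreDensity ((2 : ℝ)⁻¹ • (1 : Matrix (Fin 2) (Fin 2) ℝ)) x).PosDef} := by
  intro x hx
  have hseg : openSegment ℝ x ![1 / 4, 1 / 4, 0, 0, 0, 0, 0] ⊆ {x : Fin 7 → ℝ |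
      (rebitFibreDensity ((2 : ℝ)⁻¹ • (1 : Matrix (Fin 2) (Fin 2) ℝ)) x).PosDef} := by
    rw [openSegment_subset_iff]
    intro a b ha hb hab
    simp only [Set.mem_setOf_eq]
    rw [rebitFibreDensity_lineComb _ a b hab, rebitFibreDensity_centre]
    exact Matrix.PosDef.posSemidef_add ((show (rebitFibreDensity _ x).PosSemidef from hx).smul ha.le)
      ((Matrix.PosDef.one.smul (by norm_num : (0 : ℝ) < 1 / 4)).smul hb)
  exact closure_mono hseg (segment_subset_closure_openSegment (left_mem_segment ℝ x (![1 / 4, 1 / 4, 0, 0, 0, 0, 0] : Fin 7 → ℝ)))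

/-- `P_ℝ(½·1) ⊆ closure {ρ ≻ 0 ∧ ρ^Γ ≻ 0}`. [folklore] -/
theorem rebitFibrePPTBody_half_subset_closure :
    rebitFibrePPTBody ((2 : ℝ)⁻¹ • (1 : Matrix (Fin 2) (Fin 2) ℝ)) ⊆
      closure {x : Fin 7 → ℝ |
        (rebitFibreDensity ((2 : ℝ)⁻¹ • (1 : Matrix (Fin 2) (Fin 2) ℝ)) x).PosDef ∧
          (rebitFibreDensityPT ((2 : ℝ)⁻¹ • (1 : Matrix (Fin 2) (Fin 2) ℝ)) x).PosDef} := by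
  intro x hx
  have hseg : openSegment ℝ x ![1 / 4, 1 / 4, 0, 0, 0, 0, 0] ⊆ {x : Fin 7 → ℝ |
      (rebitFibreDensity ((2 : ℝ)⁻¹ • (1 : Matrix (Fin 2) (Fin 2) ℝ)) x).PosDef ∧
        (rebitFibreDensityPT ((2 : ℝ)⁻¹ • (1 : Matrix (Fin 2) (Fin 2) ℝ)) x).PosDef} := by
    rw [openSegment_subset_iff]
    intro a b ha hb hab
    simp only [Set.mem_setOf_eq]
    rw [rebitFibreDensity_lineComb _ a b hab, rebitFibreDensity_centre,
      rebitFibreDensityPT_lineComb _ a b hab, rebitFibreDensityPT_centre]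
    exact ⟨Matrix.PosDef.posSemidef_add
        ((show (rebitFibreDensity _ x).PosSemidef from hx.1).smul ha.le)
        ((Matrix.PosDef.one.smul (by norm_num : (0 : ℝ) < 1 / 4)).smul hb),
      Matrix.PosDef.posSemidef_add
        ((show (rebitFibreDensityPT _ x).PosSemidef from hx.2).smul ha.le)
        ((Matrix.PosDef.one.smul (by norm_num : (0 : ℝ) < 1 / 4)).smul hb)⟩
  exact closure_mono hseg (segment_subset_closure_openSegment (left_mem_segment ℝ x (![1 / 4, 1 / 4, 0, 0, 0, 0, 0] : Fin 7 → ℝ)))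

/-! ### Closed and open central fibre bodies have the same volume -/

/-- **`λ₇(D_ℝ(½·1)) = λ₇{ρ ≻ 0}`** on the central fibre: the closed body and Lovas–Andai's open
body of faithful states differ by a Lebesgue-null part of the frontier of a convex set.
[cite: LovasAndai2017, §2 (faithful states; the boundary is immaterial for volumes)] -/
theorem volume_rebitFibreBody_half_eq_posDef :
    volume (rebitFibreBody ((2 : ℝ)⁻¹ • (1 : Matrix (Fin 2) (Fin 2) ℝ))) =
      volume {x : Fin 7 → ℝ | (rebitFibreMatrix x).PosDef} := by
  rw [← rebitFibreDensity_half_eq]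
  apply le_antisymm
  · calc volume (rebitFibreBody ((2 : ℝ)⁻¹ • (1 : Matrix (Fin 2) (Fin 2) ℝ)))
        ≤ volume (closure {x : Fin 7 → ℝ |
            (rebitFibreDensity ((2 : ℝ)⁻¹ • (1 : Matrix (Fin 2) (Fin 2) ℝ)) x).PosDef}) :=
          measure_mono rebitFibreBody_half_subset_closure
      _ = volume {x : Fin 7 → ℝ |
            (rebitFibreDensity ((2 : ℝ)⁻¹ • (1 : Matrix (Fin 2) (Fin 2) ℝ)) x).PosDef} :=
          measure_closure_of_null_frontier
            ((convex_setOf_posDef_rebitFibreDensity _).addHaar_frontier volume)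
  · exact measure_mono fun x hx => Matrix.PosDef.posSemidef hx

/-- **`λ₇(P_ℝ(½·1)) = λ₇{ρ ≻ 0 ∧ ρ^Γ ≻ 0}`** on the central fibre.
[cite: LovasAndai2017, §3 (𝒟ˢ = T(𝒟) ∩ 𝒟; the boundary is immaterial for volumes)] -/
theorem volume_rebitFibrePPTBody_half_eq_posDef :
    volume (rebitFibrePPTBody ((2 : ℝ)⁻¹ • (1 : Matrix (Fin 2) (Fin 2) ℝ))) =
      volume {x : Fin 7 → ℝ | (rebitFibreMatrix x).PosDef ∧ (rebitFibreMatrixPT x).PosDef} := by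
  rw [← rebitFibreDensity_half_eq, ← rebitFibreDensityPT_half_eq]
  apply le_antisymm
  · calc volume (rebitFibrePPTBody ((2 : ℝ)⁻¹ • (1 : Matrix (Fin 2) (Fin 2) ℝ)))
        ≤ volume (closure {x : Fin 7 → ℝ |
            (rebitFibreDensity ((2 : ℝ)⁻¹ • (1 : Matrix (Fin 2) (Fin 2) ℝ)) x).PosDef ∧
              (rebitFibreDensityPT ((2 : ℝ)⁻¹ • (1 : Matrix (Fin 2) (Fin 2) ℝ)) x).PosDef}) :=
          measure_mono rebitFibrePPTBody_half_subset_closure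
      _ = volume {x : Fin 7 → ℝ |
            (rebitFibreDensity ((2 : ℝ)⁻¹ • (1 : Matrix (Fin 2) (Fin 2) ℝ)) x).PosDef ∧
              (rebitFibreDensityPT ((2 : ℝ)⁻¹ • (1 : Matrix (Fin 2) (Fin 2) ℝ)) x).PosDef} :=
          measure_closure_of_null_frontier ((convex_setOf_posDef_fibre_ppt _).addHaar_frontier volume)
  · exact measure_mono fun x hx => ⟨Matrix.PosDef.posSemidef hx.1, Matrix.PosDef.posSemidef hx.2⟩

/-! ### The discharge -/

/-- **The central fibre, closed bodies**: `64 · λ₇(P_ℝ(½·1)) = 29 · λ₇(D_ℝ(½·1))`, from the open-body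
theorem of `Literature/Probability/RandomMatrix`. [cite: LovasAndai2017, Corollary 2 and Theorem 2] -/
theorem rebitFibre_identity_half :
    64 * volume (rebitFibrePPTBody ((2 : ℝ)⁻¹ • (1 : Matrix (Fin 2) (Fin 2) ℝ))) =
      29 * volume (rebitFibreBody ((2 : ℝ)⁻¹ • (1 : Matrix (Fin 2) (Fin 2) ℝ))) := by
  rw [volume_rebitFibrePPTBody_half_eq_posDef, volume_rebitFibreBody_half_eq_posDef]
  exact Literature.Probability.RandomMatrix.LovasAndai2017_rebit_fibre_separability_probability_holds

/-- **Lovas–Andai 2017, Corollary 2 with Theorem 2, discharged: on EVERY fibre over a faithful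
reduced state the two-rebit separability probability is `29/64`** —
`∀ D ≻ 0, Tr D = 1 → 64 · λ₇(P_ℝ(D)) = 29 · λ₇(D_ℝ(D))` (closed fibre bodies of the chart
`rebitFibreDensity D`). Proof: Milz–Strunz invariance (`rebitFibre_identity_congr_iff`, the
congruence by `√2·1` maps the fibre over `½·1` onto the fibre over `1`, and
`LovasAndai2017_rebit_fibre_2964_of_one` maps that onto every faithful `D`) and the value on the
central fibre (`rebitFibre_identity_half`). [cite: LovasAndai2017, Corollary 2 and Theorem 2] -/
theorem LovasAndai2017_rebit_fibre_2964_holds : LovasAndai2017_rebit_fibre_2964 := by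
  apply LovasAndai2017_rebit_fibre_2964_of_one
  have h := (rebitFibre_identity_congr_iff sqrt_two_smul_one_conj_half.1
    ((2 : ℝ)⁻¹ • (1 : Matrix (Fin 2) (Fin 2) ℝ))).1 rebitFibre_identity_half
  rwa [sqrt_two_smul_one_conj_half.2] at h

/-- The fibre separability probability as a number: for every faithful `D` with `Tr D = 1`,
`λ₇(P_ℝ(D)) / λ₇(D_ℝ(D)) = 29/64` whenever the fibre body has positive finite volume (as it does;
stated with the hypotheses to keep this file measure-theory-light). [cite: LovasAndai2017, Corollary 2 and Theorem 2] -/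
theorem rebitFibre_separability_probability_eq {D : Matrix (Fin 2) (Fin 2) ℝ} (hD : D.PosDef)
    (htr : D.trace = 1) (h0 : volume (rebitFibreBody D) ≠ 0) (htop : volume (rebitFibreBody D) ≠ ⊤) :
    (volume (rebitFibrePPTBody D)).toReal / (volume (rebitFibreBody D)).toReal = 29 / 64 := by
  have h := LovasAndai2017_rebit_fibre_2964_holds D hD htr
  have hq : (volume (rebitFibreBody D)).toReal ≠ 0 := ENNReal.toReal_ne_zero.2 ⟨h0, htop⟩
  have hP : volume (rebitFibrePPTBody D) ≠ ⊤ :=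
    ne_top_of_le_ne_top htop (measure_mono (rebitFibrePPTBody_subset D))
  have h' := congrArg ENNReal.toReal h
  rw [ENNReal.toReal_mul, ENNReal.toReal_mul] at h'
  rw [div_eq_iff hq]
  norm_num at h'
  linarith

end Literature.InformationTheory.Entanglement

end
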